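import Summits.BirchSwinnertonDyer.Rank1Residual.GaloisImage.MazurTateLowerTaylorCoeff
import HarnessLib

/-!
# Kolyvagin's derivative operator against the Taylor coefficients of a group-ring element, and the
# Mazur–Tate element at a Kolyvagin level: `θ̄·D_n = ±δ̃_n·N` (cell `b2b-bsdres`, team n1011, seat p13
# GEN 12; T-PORT-1 §3 anatomy `cells/n1011/skel/T-PORT-1-PKIM.md` item K-iv / PK-3)

HONEST FRAMING (cell `b2b-bsdres`, run/shared/lean/b2b/bsd-rank1-residual/, verbatim in every
file): the goal of the cell is to DELETE the COMBINATION-SHAPED residual classes of the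
Birch–Swinnerton-Dyer formula for ALL analytic-rank `≤ 1` elliptic curves over `ℚ` — "full BSD
formula for every rank `≤ 1` curve in class `C`" assembled STRICTLY from published theorems — so
that the rank-`≤ 1` remainder becomes exactly the CONSTRUCTION-SHAPED classes, which are TYPED
(missing-input `Prop`s), NOT attempted. This is not "finishing BSD". Team n1011 (ROUTE 1, the PORT
anatomy (P-KIM) of class X4 ∧ `p = 3`): TOOL theorems of group-ring algebra over the tree's
`MazurTate.taylorCoeff` (`Literature/NumberTheory/EllipticCurves/MazurTateElementKuriharaCoefficient.lean`)
and n1011's R1-63/R1-64 (`GaloisImage/MazurTateTaylorCoeffTwist`, `GaloisImage/MazurTateLowerTaylorCoeff`);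
no definition, no named fact, no `sorry`; nothing is booked; no mark / label / count moves; the file
changes no END signature and no debt line (it is the algebraic half of Kim–Nakamura's Prop. 3.5, which the
PORT's value clause (DICT3) will consume together with `ZetaBody` C3a/C4/C5 — see the anatomy note).

## What

Let `G` be a finite commutative group written as a product of "cyclic coordinates": elements `σ_i`
(`i ∈ ι`) with `σ_i^{N_i} = 1` such that every `g ∈ G` is `∏ σ_i^{c_i}` with `c_i < N_i`, a
commutative ring `A` in which every `N_i = 0`, and additive characters `χ_i : G → A` READING the
coordinates (`χ_i(σ_{i'}) = δ_{ii'}`; for `G = (ℤ/n)ˣ`, `n` a square-free product of Kolyvagin primes: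
`σ_ℓ` ≡ a primitive root mod `ℓ`, `≡ 1` mod `n/ℓ`, `N_ℓ = ℓ − 1`, `χ_ℓ = log_{σ_ℓ} mod p^k` — Kim's
"primitive roots chosen to match up", Rem. 3.6).  Kolyvagin's derivative `D_i = Σ_{j<N_i} j·δ_{σ_i^j}`,
the norm elements `Nrm_i = Σ_{j<N_i} δ_{σ_i^j}`, and the Taylor coefficients
`c_T(X) = Σ_g x_g ∏_{i∈T} χ_i(g)` (`MazurTate.taylorCoeff id χ T`) satisfy, for EVERY `X ∈ A[G]`:
* **`mul_prod_deriv_eq_sum_taylorCoeff`**: `X · ∏_i D_i = Σ_{T ⊆ ι} (−1)^{|T|} c_T(X) · ∏_{i∈T} Nrm_i · ∏_{i∉T} D_i`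
  (per coordinate: the coefficient of `δ_{σ^j}` in `δ_{σ^c}·D` is `j − c` read in `A`, because
  `N = 0` there; then `∏_i (j_i − χ_i(a)) = Σ_T (−1)^{|T|} ∏_{T} χ_i(a) ∏_{ι∖T} j_i`, Mathlib
  `Finset.prod_add`; the box of exponents is re-indexed by the translation `J ↦ J + c`);
* **`mul_prod_deriv_eq_taylorCoeff_univ_smul_norm`**: if the PROPER coefficients vanish (`c_T(X) = 0`,
  `T ≠ ι`) then `X · ∏_i D_i = (−1)^{|ι|} c_ι(X) · ∏_i Nrm_i`;
* **`mapRingHom_padicLift_mul_prod_deriv_eq_kuriharaNumber_smul`** (`E/ℚ`, its newform `f`, `p` odd,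
  `E[p]` irreducible, `n ∈ 𝒩_k(E, p)`, a `p`-integral structure `Θ` of the Mazur–Tate element
  `θ̃_f(n)`): in `(ℤ/p^k)[(ℤ/n)ˣ]`, **`Θ̄ · ∏_ℓ D_ℓ = (−1)^{ν(n)} · δ̃_n · ∏_ℓ Nrm_ℓ`** with
  `δ̃_n = kuriharaNumber f (p^k) n ψ` — the lower coefficients vanish by R1-64
  (`taylorCoeff_padicLift_eq_zero_of_ssubset_of_isNewformOf`, Ota Prop. 2.3 (1) / Kim AJM 2026 §3.5
  from tree inputs) and the top one is the Kurihara number (`taylorCoeff_univ_eq_kuriharaNumber`).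
  This is C.-H. Kim, K. Nakamura, *Remarks on Kato's Euler systems for elliptic curves with additive
  reduction*, J. Number Theory 210 (2020) = arXiv:1808.07726, Prop. 3.5 (arXiv v2 p. 8; = Kim–Kim–Sun Thm. 7.5) "`D_n(Σ_a ζ_n^{a}[a/n]⁺) = Σ_a (∏_ℓ log_ℓ a)[a/n]⁺`
  in `𝔽_p`", stated in the group ring and for every `k` (applied to `ζ_n`, `∏ Nrm_ℓ ↦ Σ_{(b,n)=1} ζ_n^b = μ(n)`),
  i.e. Kim's §3.5 congruence `θ ≡ δ̃_n ∏(σ_{η_ℓ} − 1) mod (I, (σ−1)², …)` read backwards through `D`.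
CAUTION (recorded in the anatomy note): the naive reading "augmentation of `D·X` = top coefficient"
is false (`aug(D_ℓ X) = N_ℓ(N_ℓ−1)/2 · aug X`); the scalar is the coefficient along the norm element.

Why the PORT wants it (T-PORT-1-PKIM §1 (S2)–(S3)): `ZetaBody` C3a makes Kato's value map `Λ`
commute with `ℤ[Gal]`, so `Λ(D_n z) = D_n·(1 ⊗ x)`; C5 + Birch identify the group-ring element of the
values `x` with (a unit multiple of) the Mazur–Tate element; this file turns `D_n` of that element into
`±δ̃_n ×` norm — the value clause of DICT3 up to the (P-EXP) rider and the unit (S-𝔊⁻).  0 defs, 0 facts.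
Not claimed: anything about Kato's classes, `exp*`, or the imprimitive-character bookkeeping (K-ii).
References: C.-H. Kim, K. Nakamura, J. Number Theory 210 (2020) = arXiv:1808.07726 (v2), §3.2 Lemma 3.4,
Prop. 3.5 (p. 8), Rem. 3.6 (p. 9) [KimNakamura2020]; C.-H. Kim,
AJM 148 (2026) = arXiv:2203.12159 (v3) §3.5 (p. 28) [Kim2022StructureSelmer]; K. Ota, AJM 140 (2018) Prop. 2.3 (1), Prop. 3.3; M. Kurihara, arXiv:1407.2465 §1.1.
-/

noncomputable section

open Finset MonoidAlgebra
open scoped BigOperators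

namespace Summit.BirchSwinnertonDyer.Rank1Residual.GaloisImage.MazurTateDerivative

open Literature.NumberTheory.EllipticCurves Literature.NumberTheory.EllipticCurves.MazurTate

variable {A : Type*} [CommRing A] {G : Type*} [CommGroup G] {ι : Type*}

section Aux

variable (σ : ι → G) (N : ι → ℕ)

/-- Powers of an element of order dividing `N` only depend on the exponent mod `N`. [folklore] -/
theorem pow_val_add_eq {i : ι} [NeZero (N i)] (hord : σ i ^ N i = 1) (j c : Fin (N i)) :
    σ i ^ ((j + c : Fin (N i)) : ℕ) = σ i ^ (j : ℕ) * σ i ^ (c : ℕ) := by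
  rw [Fin.val_add, ← pow_add]
  conv_rhs => rw [← Nat.mod_add_div ((j : ℕ) + c) (N i), pow_add, pow_mul, hord, one_pow, mul_one]

omit [CommGroup G] in
/-- In a ring where `N = 0`, the residue `(j + c) mod N` casts to `j + c`. [folklore] -/
theorem natCast_val_add_eq {i : ι} [NeZero (N i)] (hN : ((N i : ℕ) : A) = 0) (j c : Fin (N i)) :
    (((j + c : Fin (N i)) : ℕ) : A) = (j : A) + (c : A) := by
  rw [Fin.val_add]
  have h := Nat.mod_add_div ((j : ℕ) + c) (N i)
  have h' : ((((j : ℕ) + c) % N i : ℕ) : A) + ((N i : ℕ) : A) * ((((j : ℕ) + c) / N i : ℕ) : A) =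
      (j : A) + (c : A) := by exact_mod_cast congrArg (Nat.cast (R := A)) h
  rw [hN, zero_mul, add_zero] at h'
  exact h'

end Aux

section Main

variable [Fintype ι] [DecidableEq ι]
variable (χ : ι → G →* Multiplicative A) (σ : ι → G) (N : ι → ℕ)

/-- The additive character `χ_i` reads the `i`-th coordinate of `∏ σ_{i'}^{c_{i'}}` when
`χ_i(σ_{i'}) = δ_{ii'}`. [folklore] -/
theorem toAdd_chi_prod_pow (hχ : ∀ i i', Multiplicative.toAdd (χ i (σ i')) = if i = i' then 1 else 0)
    (c : ∀ i, Fin (N i)) (i : ι) :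
    Multiplicative.toAdd (χ i (∏ i', σ i' ^ (c i' : ℕ))) = ((c i : ℕ) : A) := by
  rw [map_prod, toAdd_prod]
  simp_rw [map_pow, toAdd_pow, hχ]
  simp [Finset.sum_ite_eq, nsmul_eq_mul]

/-- Expanding a product of "cyclic" sums in the group ring over the box of exponents:
`∏_i Σ_{j<N_i} f_i(j)·δ_{σ_i^j} = Σ_J (∏_i f_i(J_i))·δ_{∏ σ_i^{J_i}}`. [folklore] -/
theorem prod_sum_single_pow_eq (f : ∀ i, Fin (N i) → A) :
    ∏ i, ∑ j : Fin (N i), single (σ i ^ (j : ℕ)) (f i j) =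
      ∑ J : ∀ i, Fin (N i), single (∏ i, σ i ^ (J i : ℕ)) (∏ i, f i (J i)) := by
  classical
  have h := Finset.prod_univ_sum (fun i => (Finset.univ : Finset (Fin (N i))))
    (fun i j => single (σ i ^ (j : ℕ)) (f i j))
  rw [Fintype.piFinset_univ] at h
  rw [h]
  exact Finset.sum_congr rfl fun J _ => prod_single _ _ _

/-- **The derivative against Taylor coefficients, on a monomial.**  With `D_i = Σ_{j<N_i} j·δ_{σ_i^j}`,
`Nrm_i = Σ_{j<N_i} δ_{σ_i^j}`, additive characters `χ_i` reading the coordinates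
(`χ_i(σ_{i'}) = δ_{ii'}`), `N_i = 0` in `A` and `σ_i^{N_i} = 1`:
`x·δ_a · ∏_i D_i = Σ_{T} (−1)^{|T|} (x ∏_{i∈T} χ_i(a)) · ∏_{i∈T} Nrm_i · ∏_{i∉T} D_i` for every
`a = ∏ σ_i^{c_i}`. [folklore] -/
theorem single_mul_prod_deriv_eq [∀ i, NeZero (N i)]
    (hχ : ∀ i i', Multiplicative.toAdd (χ i (σ i')) = if i = i' then 1 else 0)
    (hN : ∀ i, ((N i : ℕ) : A) = 0) (hord : ∀ i, σ i ^ N i = 1)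
    (c : ∀ i, Fin (N i)) (x : A) :
    single (∏ i, σ i ^ (c i : ℕ)) x * ∏ i, ∑ j : Fin (N i), single (σ i ^ (j : ℕ)) ((j : ℕ) : A) =
      ∑ T ∈ (Finset.univ : Finset ι).powerset,
        ((-1 : A) ^ T.card * (x * ∏ i ∈ T, Multiplicative.toAdd (χ i (∏ i', σ i' ^ (c i' : ℕ))))) •
          ((∏ i ∈ T, ∑ j : Fin (N i), single (σ i ^ (j : ℕ)) (1 : A)) *
            ∏ i ∈ Finset.univ \ T, ∑ j : Fin (N i), single (σ i ^ (j : ℕ)) ((j : ℕ) : A)) := by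
  classical
  -- each summand of the right side as ONE product over `univ`, then over the box
  have hT : ∀ T ∈ (Finset.univ : Finset ι).powerset,
      (∏ i ∈ T, ∑ j : Fin (N i), single (σ i ^ (j : ℕ)) (1 : A)) *
          ∏ i ∈ Finset.univ \ T, ∑ j : Fin (N i), single (σ i ^ (j : ℕ)) ((j : ℕ) : A) =
        ∑ J : ∀ i, Fin (N i), single (∏ i, σ i ^ (J i : ℕ))
          (∏ i, if i ∈ T then (1 : A) else ((J i : ℕ) : A)) := by
    intro T _
    rw [← prod_sum_single_pow_eq σ N (fun i j => if i ∈ T then (1 : A) else ((j : ℕ) : A)),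
      ← Finset.prod_filter_mul_prod_filter_not Finset.univ (· ∈ T)]
    congr 1
    · rw [Finset.filter_mem_eq_inter, Finset.univ_inter]
      exact Finset.prod_congr rfl fun i hi => by simp [hi]
    · rw [show Finset.univ.filter (fun i => ¬ i ∈ T) = Finset.univ \ T by ext i; simp]
      exact Finset.prod_congr rfl fun i hi => by
        simp [(Finset.mem_sdiff.mp hi).2]
  rw [Finset.sum_congr rfl fun T hT' => by rw [hT T hT']]
  simp_rw [Finset.smul_sum, smul_single, smul_eq_mul]
  rw [Finset.sum_comm]
  -- coefficient of `δ_{∏ σ^J}` on the right: `x · ∏_i (J_i − c_i)`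
  have hcoef : ∀ J : ∀ i, Fin (N i),
      ∑ T ∈ (Finset.univ : Finset ι).powerset,
        (-1 : A) ^ T.card * (x * ∏ i ∈ T, Multiplicative.toAdd (χ i (∏ i', σ i' ^ (c i' : ℕ)))) *
          ∏ i, (if i ∈ T then (1 : A) else ((J i : ℕ) : A)) =
        x * ∏ i, (((J i : ℕ) : A) - ((c i : ℕ) : A)) := by
    intro J
    simp_rw [toAdd_chi_prod_pow χ σ N hχ c]
    have hexp := Finset.prod_add (fun i => -((c i : ℕ) : A)) (fun i => ((J i : ℕ) : A)) Finset.univ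
    simp_rw [← sub_eq_neg_add] at hexp
    rw [hexp, Finset.mul_sum]
    refine Finset.sum_congr rfl fun T hT' => ?_
    rw [← Finset.prod_filter_mul_prod_filter_not Finset.univ (· ∈ T)
      (fun i => if i ∈ T then (1 : A) else ((J i : ℕ) : A)),
      Finset.filter_mem_eq_inter, Finset.univ_inter,
      show Finset.univ.filter (fun i => ¬ i ∈ T) = Finset.univ \ T by ext i; simp,
      Finset.prod_congr rfl fun i (hi : i ∈ T) => if_pos hi,
      Finset.prod_congr rfl fun i (hi : i ∈ Finset.univ \ T) => if_neg (Finset.mem_sdiff.mp hi).2,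
      Finset.prod_neg, Finset.prod_const]
    ring
  have hsingle : ∀ (g : G) (f : Finset ι → A),
      ∑ T ∈ (Finset.univ : Finset ι).powerset, single g (f T) =
        single g (∑ T ∈ (Finset.univ : Finset ι).powerset, f T) :=
    fun g f => (map_sum (MonoidAlgebra.singleAddHom g : A →+ MonoidAlgebra A G) f _).symm
  rw [Finset.sum_congr rfl fun J _ => by rw [hsingle, hcoef J]]
  -- the left side over the box, then translate the box by `c`
  rw [prod_sum_single_pow_eq σ N (fun i j => ((j : ℕ) : A)), Finset.mul_sum]
  simp_rw [single_mul_single]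
  refine Fintype.sum_equiv (Equiv.addRight c) _ _ fun J => ?_
  simp only [Equiv.coe_addRight, Pi.add_apply]
  congr 1
  · rw [← Finset.prod_mul_distrib]
    exact Finset.prod_congr rfl fun i _ => by rw [mul_comm, ← pow_val_add_eq σ N (hord i)]
  · congr 1
    exact Finset.prod_congr rfl fun i _ => by rw [natCast_val_add_eq N (hN i), add_sub_cancel_right]

/-- **Kolyvagin's derivative against the Taylor coefficients (Kim–Nakamura 2020 Prop. 3.5 / Kim AJM 2026 §3.5 read
backwards).**  In `A[G]` with `G = ∏_i ⟨σ_i⟩` (every element a product of powers `σ_i^{c_i}`, `c_i < N_i`,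
`σ_i^{N_i} = 1`, `N_i = 0` in `A`) and additive characters `χ_i` reading the coordinates:
`X · ∏_i D_i = Σ_{T ⊆ ι} (−1)^{|T|} c_T(X) · ∏_{i∈T} Nrm_i · ∏_{i∉T} D_i`,
`D_i = Σ_{j<N_i} j δ_{σ_i^j}`, `Nrm_i = Σ_{j<N_i} δ_{σ_i^j}`, `c_T = MazurTate.taylorCoeff id χ T`. [folklore] -/
theorem mul_prod_deriv_eq_sum_taylorCoeff [∀ i, NeZero (N i)]
    (hχ : ∀ i i', Multiplicative.toAdd (χ i (σ i')) = if i = i' then 1 else 0)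
    (hN : ∀ i, ((N i : ℕ) : A) = 0) (hord : ∀ i, σ i ^ N i = 1)
    (hgen : ∀ a : G, ∃ c : ∀ i, Fin (N i), a = ∏ i, σ i ^ (c i : ℕ)) (X : MonoidAlgebra A G) :
    X * ∏ i, ∑ j : Fin (N i), single (σ i ^ (j : ℕ)) ((j : ℕ) : A) =
      ∑ T ∈ (Finset.univ : Finset ι).powerset,
        ((-1 : A) ^ T.card * taylorCoeff (RingHom.id A) χ T X) •
          ((∏ i ∈ T, ∑ j : Fin (N i), single (σ i ^ (j : ℕ)) (1 : A)) *
            ∏ i ∈ Finset.univ \ T, ∑ j : Fin (N i), single (σ i ^ (j : ℕ)) ((j : ℕ) : A)) := by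
  induction X using MonoidAlgebra.induction_linear with
  | zero => simp
  | add X Y hX hY =>
    rw [add_mul, hX, hY, ← Finset.sum_add_distrib]
    refine Finset.sum_congr rfl fun T _ => ?_
    rw [map_add, mul_add, add_smul]
  | single a x =>
    obtain ⟨c, rfl⟩ := hgen a
    rw [single_mul_prod_deriv_eq χ σ N hχ hN hord c x]
    refine Finset.sum_congr rfl fun T _ => ?_
    rw [taylorCoeff_single, RingHom.id_apply]

/-- **Corollary: with vanishing lower Taylor coefficients the derivative is the top coefficient times
the norm element** — `X · ∏_i D_i = (−1)^{|ι|} c_ι(X) · ∏_i Nrm_i` when `c_T(X) = 0` for every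
`T ≠ ι` (at a Kolyvagin level this is the tree's R1-64 `taylorCoeff_padicLift_eq_zero_of_ssubset_…`,
and `c_ι` is the Kurihara number, `taylorCoeff_univ_eq_kuriharaNumber`). [folklore] -/
theorem mul_prod_deriv_eq_taylorCoeff_univ_smul_norm [∀ i, NeZero (N i)]
    (hχ : ∀ i i', Multiplicative.toAdd (χ i (σ i')) = if i = i' then 1 else 0)
    (hN : ∀ i, ((N i : ℕ) : A) = 0) (hord : ∀ i, σ i ^ N i = 1)
    (hgen : ∀ a : G, ∃ c : ∀ i, Fin (N i), a = ∏ i, σ i ^ (c i : ℕ)) (X : MonoidAlgebra A G)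
    (hlow : ∀ T : Finset ι, T ≠ Finset.univ → taylorCoeff (RingHom.id A) χ T X = 0) :
    X * ∏ i, ∑ j : Fin (N i), single (σ i ^ (j : ℕ)) ((j : ℕ) : A) =
      ((-1 : A) ^ Fintype.card ι * taylorCoeff (RingHom.id A) χ Finset.univ X) •
        ∏ i, ∑ j : Fin (N i), single (σ i ^ (j : ℕ)) (1 : A) := by
  rw [mul_prod_deriv_eq_sum_taylorCoeff χ σ N hχ hN hord hgen X,
    Finset.sum_eq_single_of_mem Finset.univ (Finset.mem_powerset_self _)]
  · rw [Finset.card_univ, Finset.sdiff_self, Finset.prod_empty, mul_one]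
  · intro T _ hT
    rw [hlow T hT, mul_zero, zero_smul]

omit [Fintype ι] [DecidableEq ι] in
/-- Taylor coefficients through a coefficient reduction `φ`: `c_T^{φ}(X) = c_T^{id}(φ_* X)`. [folklore] -/
theorem taylorCoeff_eq_taylorCoeff_mapRingHom {R : Type*} [CommRing R] (φ : R →+* A)
    (T : Finset ι) (X : MonoidAlgebra R G) :
    taylorCoeff φ χ T X = taylorCoeff (RingHom.id A) χ T (MonoidAlgebra.mapRingHom G φ X) := by
  induction X using MonoidAlgebra.induction_linear with
  | zero => simp
  | add X Y hX hY => rw [map_add, hX, hY, map_add, map_add]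
  | single a x => rw [MonoidAlgebra.mapRingHom_single, taylorCoeff_single, taylorCoeff_single, RingHom.id_apply]

end Main

end Summit.BirchSwinnertonDyer.Rank1Residual.GaloisImage.MazurTateDerivative

/-! ## §3 The Mazur–Tate element at a Kolyvagin level: `θ̄ · D_n = ± δ̃_n · N` (Kim–Nakamura Prop. 3.5) -/

namespace Summit.BirchSwinnertonDyer.Rank1Residual.GaloisImage.MazurTateDerivative

open Literature.NumberTheory.EllipticCurves Literature.NumberTheory.EllipticCurves.ModularForms
open Literature.NumberTheory.EllipticCurves.MazurTate CongruenceSubgroup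
open Summit.BirchSwinnertonDyer.Rank1Residual.Supersingular.KuriharaTwist.Identity
open scoped MatrixGroups ModularForm

variable {N₀ : ℕ} [NeZero N₀] (f : CuspForm (Gamma0 N₀) 2) {p : ℕ} [hp : Fact p.Prime] (k : ℕ)
variable {W : WeierstrassCurve ℚ} [W.IsElliptic] [W.IsGloballyMinimal]

/-- **The Kolyvagin derivative of the Mazur–Tate element at a Kolyvagin level is the Kurihara number
times the norm element** (Kim–Nakamura, JNT 210 (2020) = arXiv:1808.07726 v2, Prop. 3.5 p. 8 [= Kim–Kim–Sun Thm. 7.5],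
Rem. 3.6 p. 9; C.-H. Kim, AJM 148 (2026) = arXiv:2203.12159 v3 §3.5 p. 28's congruence read backwards).  For the newform `f` of `E`, `p` odd, `E[p]`
irreducible, `n ∈ 𝒩_k(E, p)`, a `p`-integral structure `Θ` of `θ̃_f(n)`, elements `σ_ℓ ∈ (ℤ/n)ˣ`
(`ℓ ∣ n`) of order dividing `ℓ − 1` such that every unit is a product `∏ σ_ℓ^{c_ℓ}` (`c_ℓ < ℓ − 1`)
and discrete logarithms `ψ_ℓ` READING THESE COORDINATES (`ψ_ℓ(σ_{ℓ′} mod ℓ) = δ_{ℓℓ′}` — Kim's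
"primitive roots chosen to match up", Rem. 3.6), in `(ℤ/p^k)[(ℤ/n)ˣ]`:
`Θ̄ · ∏_ℓ D_ℓ = (−1)^{ν(n)} δ̃_n · ∏_ℓ Nrm_ℓ`, `D_ℓ = Σ_{j<ℓ−1} j δ_{σ_ℓ^j}`, `Nrm_ℓ = Σ_{j<ℓ−1} δ_{σ_ℓ^j}`,
`δ̃_n = kuriharaNumber f (p^k) n ψ`.  Inputs: the generic identity
`mul_prod_deriv_eq_taylorCoeff_univ_smul_norm`, R1-64's vanishing of the lower Taylor coefficients
(`taylorCoeff_padicLift_eq_zero_of_ssubset_of_isNewformOf`) and `taylorCoeff_univ_eq_kuriharaNumber`.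
[cite: KimNakamura2020, Prop. 3.5 and Rem. 3.6 (arXiv v2 pp. 8–9)]
[cite: Kim2022StructureSelmer, §3.5 (arXiv v3 p. 28)] -/
theorem mapRingHom_padicLift_mul_prod_deriv_eq_kuriharaNumber_smul (hf : IsNewformOf W f)
    (hp2 : p ≠ 2) (hirr : W.HasIrreducibleModPGaloisRep p) {n : ℕ} [NeZero n]
    (hn : Kato.IsKolyvaginProduct W p k n)
    (ψ : (ℓ : ℕ) → (ZMod ℓ)ˣ →* Multiplicative (ZMod (p ^ k)))
    {Θ : MonoidAlgebra ℤ_[p] (ZMod n)ˣ}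
    (hΘ : ∀ a : (ZMod n)ˣ, ((Θ.coeff a : ℤ_[p]) : ℚ_[p]) =
      ((ratPlusSymbol f (((a : ZMod n).val : ℚ) / n) : ℚ) : ℚ_[p]))
    (σ : n.primeFactors → (ZMod n)ˣ)
    (hσψ : ∀ ℓ ℓ' : n.primeFactors, Multiplicative.toAdd
      (ψ ℓ.1 (ZMod.unitsMap (Nat.dvd_of_mem_primeFactors ℓ.2) (σ ℓ'))) = if ℓ = ℓ' then 1 else 0)
    (hord : ∀ ℓ : n.primeFactors, σ ℓ ^ ((ℓ : ℕ) - 1) = 1)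
    (hgen : ∀ a : (ZMod n)ˣ, ∃ c : ∀ ℓ : n.primeFactors, Fin ((ℓ : ℕ) - 1),
      a = ∏ ℓ, σ ℓ ^ (c ℓ : ℕ)) :
    MonoidAlgebra.mapRingHom (ZMod n)ˣ (PadicInt.toZModPow k) Θ *
        ∏ ℓ : n.primeFactors, ∑ j : Fin ((ℓ : ℕ) - 1), single (σ ℓ ^ (j : ℕ)) ((j : ℕ) : ZMod (p ^ k)) =
      ((-1 : ZMod (p ^ k)) ^ n.primeFactors.card * kuriharaNumber f (p ^ k) n ψ) •
        ∏ ℓ : n.primeFactors, ∑ j : Fin ((ℓ : ℕ) - 1), single (σ ℓ ^ (j : ℕ)) (1 : ZMod (p ^ k)) := by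
  classical
  haveI : ∀ ℓ : n.primeFactors, NeZero ((ℓ : ℕ) - 1) :=
    fun ℓ => ⟨Nat.sub_ne_zero_of_lt (Nat.prime_of_mem_primeFactors ℓ.2).one_lt⟩
  have hN : ∀ ℓ : n.primeFactors, ((((ℓ : ℕ) - 1 : ℕ) : ℕ) : ZMod (p ^ k)) = 0 := by
    intro ℓ
    have hK := hn.isKolyvaginPrime (Nat.prime_of_mem_primeFactors ℓ.2) (Nat.dvd_of_mem_primeFactors ℓ.2)
    have h1 : (1 : ℕ) ≤ (ℓ : ℕ) := (Nat.prime_of_mem_primeFactors ℓ.2).one_lt.le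
    rw [ZMod.natCast_eq_zero_iff]
    exact (Nat.modEq_iff_dvd' h1).mp hK.modEq_one.symm
  rw [mul_prod_deriv_eq_taylorCoeff_univ_smul_norm
      (fun ℓ : n.primeFactors => (ψ ℓ.1).comp (ZMod.unitsMap (Nat.dvd_of_mem_primeFactors ℓ.2)))
      σ (fun ℓ => (ℓ : ℕ) - 1) (fun ℓ ℓ' => by rw [MonoidHom.comp_apply]; exact hσψ ℓ ℓ') hN hord hgen _
      (fun T hT => ?_)]
  · rw [← taylorCoeff_eq_taylorCoeff_mapRingHom, taylorCoeff_univ_eq_kuriharaNumber f p k n ψ hΘ,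
      Fintype.card_coe]
  · rw [← taylorCoeff_eq_taylorCoeff_mapRingHom]
    exact taylorCoeff_padicLift_eq_zero_of_ssubset_of_isNewformOf f k hf hp2 hirr hn ψ hΘ T
      (Finset.ssubset_iff_subset_ne.mpr ⟨Finset.subset_univ T, hT⟩)

end Summit.BirchSwinnertonDyer.Rank1Residual.GaloisImage.MazurTateDerivative

end
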